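import Summits.BirchSwinnertonDyer.BirchSwinnertonDyer.Theorems.EisensteinPrimesGoodLatticeAnacongEulerCompMultiplicative
import Summits.BirchSwinnertonDyer.BirchSwinnertonDyer.Theorems.ErratumRoadFiveSigmaEulerFactorFirstUnitCoeff
import Summits.BirchSwinnertonDyer.BirchSwinnertonDyer.Theorems.ClassRecordThreeLambdaMatchingTransferAlgebra
import Summits.BirchSwinnertonDyer.BirchSwinnertonDyer.Theorems.EisensteinPrimesCrystalLambdaSigmaLocal
import Literature.NumberTheory.GaloisRepresentations.ResidualPairIntegrality
import Literature.NumberTheory.EllipticCurves.AdditiveReductionSemistableModelProofs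
import HarnessLib

/-!
# The character Euler ELEMENT `𝒫_w(θ)^{±ι} = 1 − u·(1+T)^{±c_w} ∈ R₀⟦T⟧` has its first unit coefficient EXACTLY at
# Keller–Yin's `charLocalLambda S κ θ w`; and `μ`/`λ` under an Eisenstein congruence `L ≡ U·E²·F² (mod 𝔪)`
# (cell `bsd-eis`, width seat `bsd-line-x1-p1-w2` gen 26; helper for crux 2 `GoodLatticeBDPValue`, `--supports stmt-BirchSwinnertonDyer-19032`)

WHY. Castella–Grossi–Lee–Skinner 2022 prove Thm. 2.2.2 (the `λ`-identity the content stub 3a-A of crux 2 asserts, in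
Keller–Yin's shape) from Thm. 2.2.1 (`𝓛_E ≡ (𝓔^ι_{φ,ψ})²·𝓛_φ² (mod pΛ^{ur})`) in half a page: `λ`, `μ` are invariants of the
reduction mod `𝔪`; `λ` of a product adds; `λ(𝒫_w(θ)) = [Γ : Γ_w]·𝟙[θ(Frob_w) ≡ ℓ]` for the local Euler element
`𝒫_w(θ) = 1 − θ(ℓ)ℓ⁻¹γ_w`, unchanged by the involution `ι : γ ↦ γ⁻¹`. The tree has the closed-form NUMBER
`KellerYin2024.charLocalLambda` and (width seats -w2 g22–g24) the whole (eq:Euler-comp) bookkeeping in that currency; this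
file supplies the two generic kernel facts a CONGRUENCE-currency typing of Thm. 2.2.1 needs on top (g22 SIZING §2, «NOT found»):
* §1 `firstUnitCoeffAt_unit_mul_sq_mul_sq`, `firstUnitCoeffAt_of_congr_unit_mul_sq_mul_sq` — `FU(E, e)`, `FU(F, m)`, `U` a unit,
  `L ≡ U·E²·F²` coefficientwise mod `𝔪_{R₀}` ⟹ `FU(L, 2(e + m))`.
* §2 `firstUnitCoeffAt_charEulerElement` — for a rank-one `θ : Γ_K → GL₁(𝒪)` unramified at a degree-one place `w ∋ ℓ ≠ p` of
  an imaginary quadratic `K`, `κ` anticyclotomic (`c_w ≠ 0`, Brink), `u ∈ R₀` with `u·ℓ ≡ θ(Frob_w)`, `b ∈ {c_w, −c_w}`: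
  `FirstUnitCoeffAt (1 − u·(1+T)^b) (charLocalLambda S κ θ w)`; `firstUnitCoeffAt_one_of_not_isUnramifiedAt` (ramified: the
  element is `1`, index `0`); `frobActsAsNormAt_iff_norm_sub_lt`; small norm / valuation plumbing (`v(−x) = v(x)` is the
  tree's `padicInt_valuation_neg`).

HONEST FRAMING: theorems about the tree's own objects (`UnrSeries`, `FirstUnitCoeffAt`, `charLocalLambda`, `numPlacesAbove`,
`frobExponentAt`); 0 definitions, 0 named facts, 0 sorry; no `p`-adic `L`-function, congruence, Selmer group or case of BSD is
constructed, asserted or proved; closes no stub; 0 cells / labels / tiers move. Consumer: the companion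
`EisensteinPrimesGoodLatticeAnacongOfEisensteinCongruence.lean` (3a-A's conclusion from a CGLS 2.2.1-shaped congruence).
References: [CastellaGrossiLeeSkinner2022] proof of Thm. 2.2.2 (arXiv:2008.02571v2 §2.2); [GreenbergVatsal2000] §2 Prop. (2.4);
[Washington1997] §7.1 Prop. 7.2; [KellerYin2024] Lemma 1.1.1 (arXiv:2402.12781v2); [Brink2007] Thm. 2.
-/

set_option autoImplicit false
set_option linter.dupNamespace false

noncomputable section

open scoped Classical

open NumberField IsDedekindDomain Field WeierstrassCurve PowerSeries
  Literature.NumberTheory.EllipticCurves Literature.NumberTheory.GaloisRepresentations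
  Literature.NumberTheory.EllipticCurves.GreenbergSelmer
  Literature.NumberTheory.EllipticCurves.Rank1Residual
  Literature.NumberTheory.EllipticCurves.KellerYin2024
  Summit.BirchSwinnertonDyer.Rank1Residual.X11b.Halves
  Summit.BirchSwinnertonDyer.Rank1Residual.X1.KellerYinHalves

namespace Summit.BirchSwinnertonDyer.BirchSwinnertonDyer.Theorems.GoodLatticeAnacongCharEulerElement

variable {p : ℕ} [hp : Fact p.Prime] {S : Set (PadicAlgCl p)}

/-! ## §1 Generic `R₀⟦T⟧` calculus: the first unit coefficient under an Eisenstein congruence -/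

section Generic

/-- **`FU(U·E²·F², 2(e + m))`** from `FU(E, e)`, `FU(F, m)` and `U` a unit (Gauss's lemma for the first unit
coefficient, `LambdaMatching.firstUnitCoeffAt_unit_mul`, `UnrSeriesFirstUnitCoeff.firstUnitCoeffAt_mul`).
[cite: Washington1997, §7.1 Prop. 7.2] -/
theorem firstUnitCoeffAt_unit_mul_sq_mul_sq {U E F : UnrSeries p} (hU : IsUnit U) {e m : ℕ}
    (hE : FirstUnitCoeffAt E e) (hF : FirstUnitCoeffAt F m) :
    FirstUnitCoeffAt (U * E ^ 2 * F ^ 2) (2 * (e + m)) := by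
  have hE2 : FirstUnitCoeffAt (E ^ 2) (e + e) := by
    rw [sq]; exact firstUnitCoeffAt_mul hE hE
  have hF2 : FirstUnitCoeffAt (F ^ 2) (m + m) := by
    rw [sq]; exact firstUnitCoeffAt_mul hF hF
  have hUE2 : FirstUnitCoeffAt (U * E ^ 2) (e + e) := LambdaMatching.firstUnitCoeffAt_unit_mul hU hE2
  have h := firstUnitCoeffAt_mul hUE2 hF2
  rwa [show e + e + (m + m) = 2 * (e + m) by ring] at h

/-- **The first unit coefficient under an Eisenstein congruence.** If `L ≡ U·E²·F²` coefficientwise modulo the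
maximal ideal of `R₀` (each `‖L_i − (U E² F²)_i‖ < 1`), `U` is a unit of `R₀⟦T⟧`, `FU(E, e)` and `FU(F, m)`, then
`FU(L, 2(e + m))`: `μ(L) = 0` and `λ(L) = 2λ(E) + 2λ(F)` — the `μ`/`λ` step of CGLS's proof of Thm. 2.2.2 from Thm. 2.2.1.
[cite: CastellaGrossiLeeSkinner2022, proof of Thm. 2.2.2 (arXiv:2008.02571v2 §2.2)] [cite: Washington1997, §7.1 Prop. 7.2] -/
theorem firstUnitCoeffAt_of_congr_unit_mul_sq_mul_sq {L U E F : UnrSeries p} (hU : IsUnit U) {e m : ℕ}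
    (hE : FirstUnitCoeffAt E e) (hF : FirstUnitCoeffAt F m)
    (hcong : ∀ i, ‖((coeff i L : unrIntegers p) : ℂ_[p]) - ((coeff i (U * E ^ 2 * F ^ 2) : unrIntegers p) : ℂ_[p])‖ < 1) :
    FirstUnitCoeffAt L (2 * (e + m)) := by
  refine LambdaMatching.firstUnitCoeffAt_of_congr (fun i ↦ ?_) (firstUnitCoeffAt_unit_mul_sq_mul_sq hU hE hF)
  rw [norm_sub_rev]
  exact hcong i

end Generic

/-! ## §2 ONE place: the first unit coefficient of the character Euler element `1 − u·(1+T)^{±c_w}` -/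

section Place

variable {K : Type} [Field K] [NumberField K]

/-- `‖ℓ‖ = 1` in `ℂ_p` for a prime `ℓ ≠ p`. [folklore] -/
theorem norm_natCast_eq_one_of_prime_ne {ℓ : ℕ} (hℓ : ℓ.Prime) (hℓp : ℓ ≠ p) : ‖(ℓ : ℂ_[p])‖ = 1 := by
  have h : ‖(ℓ : ℚ_[p])‖ = 1 :=
    Padic.norm_natCast_eq_one_iff.mpr ((Nat.coprime_primes hp.out hℓ).mpr (Ne.symm hℓp))
  rw [← PadicComplex.norm_extends' p (ℓ : ℚ_[p])] at h
  simpa using h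

/-- A place containing the prime `ℓ ≠ p` does not contain `p`. [folklore] -/
theorem natCast_not_mem_of_natCast_mem {w : HeightOneSpectrum (𝓞 K)} {ℓ : ℕ} (hℓ : ℓ.Prime) (hℓp : ℓ ≠ p)
    (hw : ((ℓ : ℕ) : 𝓞 K) ∈ w.asIdeal) : ((p : ℕ) : 𝓞 K) ∉ w.asIdeal := by
  intro hpw
  have hℓv : ((ℓ : ℕ) : 𝓞 ℚ) ∈ (w.under (𝓞 ℚ)).asIdeal := by
    change ((ℓ : ℕ) : 𝓞 ℚ) ∈ w.asIdeal.comap (algebraMap (𝓞 ℚ) (𝓞 K))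
    rw [Ideal.mem_comap, map_natCast]; exact hw
  have hpv : ((p : ℕ) : 𝓞 ℚ) ∈ (w.under (𝓞 ℚ)).asIdeal := by
    change ((p : ℕ) : 𝓞 ℚ) ∈ w.asIdeal.comap (algebraMap (𝓞 ℚ) (𝓞 K))
    rw [Ideal.mem_comap, map_natCast]; exact hpw
  have e1 := Rat.HeightOneSpectrum.natGenerator_eq_of_natCast_mem (w.under (𝓞 ℚ)) hℓ hℓv
  have e2 := Rat.HeightOneSpectrum.natGenerator_eq_of_natCast_mem (w.under (𝓞 ℚ)) hp.out hpv
  exact hℓp (e1.symm.trans e2)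

/-- The valuation of `p^s · b′` (`b′ ∈ ℤ_p^×`) is `s`. [folklore] -/
theorem valuation_pow_mul_of_isUnit (s : ℕ) {b' : ℤ_[p]} (hb' : IsUnit b') :
    ((p : ℤ_[p]) ^ s * b').valuation = s := by
  have hb'0 : b' ≠ 0 := hb'.ne_zero
  have hv : b'.valuation = 0 := by
    have h1 : ‖b'‖ = 1 := PadicInt.isUnit_iff.mp hb'
    rw [PadicInt.norm_eq_zpow_neg_valuation hb'0] at h1
    have hp1 : (1 : ℝ) < p := by exact_mod_cast hp.out.one_lt
    have := (zpow_right_injective₀ (zero_lt_one.trans hp1) hp1.ne') (h1.trans (zpow_zero _).symm)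
    omega
  rw [PadicInt.valuation_p_pow_mul s b' hb'0, hv, add_zero]

/-- **`FrobActsAsNormAt S θ w ↔ ‖θ(Frob_w) − ℓ‖ < 1`** for a rank-one `θ` unramified at `w`, with `θ(Frob_w)` read as ANY
`a` with `θ.HasFrobCharpolyAt w (X − a)` (unique: `FramedGaloisRep.HasFrobCharpolyAt.unique`) and `Nw = ℓ`.
[cite: KellerYin2024, Lemma 1.1.1 (arXiv:2402.12781v2 TeX L455–462)] [cite: SerreAbelianLadic1968, Ch. I §2.1] -/
theorem frobActsAsNormAt_iff_norm_sub_lt {θ : FramedGaloisRep K (padicCoeffIntegers S) 1}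
    {w : HeightOneSpectrum (𝓞 K)} (hθ : θ.IsUnramifiedAt w) {a : padicCoeffIntegers S}
    (ha : θ.HasFrobCharpolyAt w (Polynomial.X - Polynomial.C a)) {ℓ : ℕ} (hN : Ideal.absNorm w.asIdeal = ℓ) :
    FrobActsAsNormAt S θ w ↔ ‖(a : PadicAlgCl p) - (ℓ : PadicAlgCl p)‖ < 1 := by
  constructor
  · rintro ⟨-, a', ha', hn⟩
    have he : a = a' := by
      have h := FramedGaloisRep.HasFrobCharpolyAt.unique ha ha'
      rwa [sub_right_inj, Polynomial.C_inj] at h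
    rw [he, ← hN]
    exact hn
  · intro hlt
    refine ⟨hθ, a, ha, ?_⟩
    rw [hN]
    exact hlt

/-- **ONE PLACE — the first unit coefficient of the character Euler element.** `θ : Γ_K → GL₁(𝒪)` rank one, unramified
at a place `w ∋ ℓ` of residue degree one (`Nw = ℓ`), `ℓ ≠ p` prime, `K` imaginary quadratic, `κ` anticyclotomic (so
`c_w = κ(Frob_w) ≠ 0` and `[Γ : Γ_w] = p^{v_p(c_w)}`, Brink), `θ(Frob_w) = a`, `u ∈ R₀` with `u·ℓ ≡ a (mod 𝔪)` (i.e.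
`u ≡ θ(Frob_w)ℓ⁻¹`), `b ∈ {c_w, −c_w}`: the element `1 − u·(1+T)^b ∈ R₀⟦T⟧` — CGLS's `𝒫_w(θ) = 1 − θ(ℓ)ℓ⁻¹γ_w` or its image
`𝒫_w(θ)^ι` under `γ ↦ γ⁻¹` — has `μ = 0` and its first unit coefficient EXACTLY at `charLocalLambda S κ θ w =
[Γ : Γ_w]·𝟙[θ(Frob_w) ≡ ℓ]` (Greenberg–Vatsal Prop. 2.4: `λ = s_ℓ d_ℓ`; CGLS proof of Thm. 2.2.2: "the involution … preserves
`λ`-invariants"). [cite: CastellaGrossiLeeSkinner2022, proof of Thm. 2.2.2 (λ(𝒫_w(θ)), the involution ι)]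
[cite: GreenbergVatsal2000, §2 Prop. (2.4)] [cite: KellerYin2024, Lemma 1.1.1 (arXiv:2402.12781v2 TeX L455–462)] -/
theorem firstUnitCoeffAt_charEulerElement (hK : IsImaginaryQuadratic K) (hp2 : 2 < p) {κ : ZpExtension K p}
    (hκ : κ.IsAnticyclotomic) {θ : FramedGaloisRep K (padicCoeffIntegers S) 1} {w : HeightOneSpectrum (𝓞 K)}
    (hθ : θ.IsUnramifiedAt w) {ℓ : ℕ} (hℓ : ℓ.Prime) (hℓp : ℓ ≠ p) (hw : ((ℓ : ℕ) : 𝓞 K) ∈ w.asIdeal)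
    (he : w.asIdeal.ramificationIdx (𝓞 ℚ) = 1) (hf : w.asIdeal.inertiaDeg (𝓞 ℚ) = 1)
    {a : padicCoeffIntegers S} (ha : θ.HasFrobCharpolyAt w (Polynomial.X - Polynomial.C a))
    {u : unrIntegers p} (hu : ‖(u : ℂ_[p]) * (ℓ : ℂ_[p]) - ((a : PadicAlgCl p) : ℂ_[p])‖ < 1)
    {b : ℤ_[p]} (hb : b = κ.frobExponentAt w ∨ b = -κ.frobExponentAt w) :
    FirstUnitCoeffAt (1 - C u * (binomialSeries ℤ_[p] b).map (toUnr p)) (charLocalLambda S κ θ w) := by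
  have hpp := hp.out
  have hN : Ideal.absNorm w.asIdeal = ℓ :=
    GoodLatticeAnacongEulerCompMultiplicative.absNorm_eq_of_inertiaDeg_eq_one hℓ hw hf
  have hpw : ((p : ℕ) : 𝓞 K) ∉ w.asIdeal := natCast_not_mem_of_natCast_mem hℓ hℓp hw
  have hc : κ.frobExponentAt w ≠ 0 := κ.frobExponentAt_ne_zero_of_degree_one hK (by omega) hκ hpw he hf
  have hb0 : b ≠ 0 := by
    rcases hb with rfl | rfl
    · exact hc
    · exact neg_ne_zero.mpr hc
  have hbv : b.valuation = (κ.frobExponentAt w).valuation := by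
    rcases hb with rfl | rfl
    · rfl
    · exact Literature.NumberTheory.EllipticCurves.padicInt_valuation_neg _
  have hnP : numPlacesAbove κ w = p ^ b.valuation := by
    rw [hbv]; exact CrystalLambdaSigma.numPlacesAbove_eq_pow_valuation_frobExponentAt κ hpw hc
  -- norms in `ℂ_p`
  set x : ℂ_[p] := ((a : PadicAlgCl p) : ℂ_[p]) with hx
  have hℓ1 : ‖(ℓ : ℂ_[p])‖ = 1 := norm_natCast_eq_one_of_prime_ne hℓ hℓp
  have hxle : ‖x‖ ≤ 1 := by rw [hx, PadicComplex.norm_extends]; exact a.2.2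
  have hxℓ : ‖x - (ℓ : ℂ_[p])‖ = ‖(a : PadicAlgCl p) - (ℓ : PadicAlgCl p)‖ := by
    rw [hx, ← PadicComplex.coe_natCast, ← UniformSpace.Completion.coe_sub, PadicComplex.norm_extends]
  have hkey : ((1 : ℂ_[p]) - (u : ℂ_[p])) * (ℓ : ℂ_[p]) = ((ℓ : ℂ_[p]) - x) + (x - (u : ℂ_[p]) * (ℓ : ℂ_[p])) := by
    ring
  have hnorm1u : ‖(1 : ℂ_[p]) - (u : ℂ_[p])‖ = ‖((ℓ : ℂ_[p]) - x) + (x - (u : ℂ_[p]) * (ℓ : ℂ_[p]))‖ := by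
    rw [← hkey, norm_mul, hℓ1, mul_one]
  have hsmall : ‖x - (u : ℂ_[p]) * (ℓ : ℂ_[p])‖ < 1 := by rw [norm_sub_rev]; exact hu
  by_cases hF : FrobActsAsNormAt S θ w
  · -- `θ(Frob_w) ≡ ℓ`: `u ≡ 1`, first unit coefficient at `p^{v(b)} = [Γ : Γ_w]`
    have hlt : ‖x - (ℓ : ℂ_[p])‖ < 1 := by
      rw [hxℓ]; exact (frobActsAsNormAt_iff_norm_sub_lt hθ ha hN).mp hF
    have hu1 : ‖(1 : ℂ_[p]) - (u : ℂ_[p])‖ < 1 := by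
      rw [hnorm1u]
      refine (IsUltrametricDist.norm_add_le_max _ _).trans_lt (max_lt ?_ hsmall)
      rwa [norm_sub_rev]
    rw [charLocalLambda_of_frobActsAsNormAt S κ θ w hF, hnP]
    have hspec : b = (p : ℤ_[p]) ^ b.valuation * (PadicInt.unitCoeff hb0 : ℤ_[p]) := by
      rw [mul_comm]; exact PadicInt.unitCoeff_spec hb0
    rw [hspec, valuation_pow_mul_of_isUnit _ (PadicInt.unitCoeff hb0).isUnit]
    exact SigmaFactorFU.firstUnitCoeffAt_pow_one_sub_C_mul hu1 _ (PadicInt.unitCoeff hb0).isUnit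
  · -- `θ(Frob_w) ≢ ℓ`: `u ≢ 1`, unit constant term
    have hge : ‖x - (ℓ : ℂ_[p])‖ = 1 := by
      refine le_antisymm ?_ ?_
      · rw [sub_eq_add_neg]
        exact (IsUltrametricDist.norm_add_le_max _ _).trans (max_le hxle (by rw [norm_neg]; exact hℓ1.le))
      · rw [hxℓ]
        exact not_lt.mp fun h ↦ hF ((frobActsAsNormAt_iff_norm_sub_lt hθ ha hN).mpr h)
    have hu1 : ‖(1 : ℂ_[p]) - (u : ℂ_[p])‖ = 1 := by
      rw [hnorm1u]
      have hne : ‖(ℓ : ℂ_[p]) - x‖ ≠ ‖x - (u : ℂ_[p]) * (ℓ : ℂ_[p])‖ := by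
        rw [norm_sub_rev, hge]; exact hsmall.ne'
      rw [IsUltrametricDist.norm_add_eq_max_of_norm_ne_norm hne, norm_sub_rev (ℓ : ℂ_[p]), hge,
        max_eq_left hsmall.le]
    rw [charLocalLambda_of_not_frobActsAsNormAt S κ θ w hF]
    exact SigmaFactorFU.firstUnitCoeffAt_zero_one_sub_C_mul hu1 b

/-- **The element is `1` when `θ` is RAMIFIED at `w`** (`F(θ)_{I_w} = 0`, `P_w = 1`, as printed): first unit coefficient at
`0 = charLocalLambda S κ θ w`. [cite: KellerYin2024, Lemma 1.1.1 (arXiv:2402.12781v2)] -/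
theorem firstUnitCoeffAt_one_of_not_isUnramifiedAt (κ : ZpExtension K p)
    {θ : FramedGaloisRep K (padicCoeffIntegers S) 1} {w : HeightOneSpectrum (𝓞 K)} (hθ : ¬ θ.IsUnramifiedAt w) :
    FirstUnitCoeffAt (1 : UnrSeries p) (charLocalLambda S κ θ w) := by
  rw [charLocalLambda_of_not_frobActsAsNormAt S κ θ w (fun h ↦ hθ h.1)]
  exact SigmaFactorFU.firstUnitCoeffAt_one

end Place

end Summit.BirchSwinnertonDyer.BirchSwinnertonDyer.Theorems.GoodLatticeAnacongCharEulerElement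

end
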